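import Summits.ABC.IUTFork.Conditional.RefBandsInhDiffM
import Summits.ABC.IUTFork.Conditional.RefBandsInhTypeBandsMA
import Summits.ABC.IUTFork.Conditional.RefBandsInhTypeBandsMB
import Summits.ABC.IUTFork.Conditional.TSRefMTwinsA
import Summits.ABC.IUTFork.Conditional.TSRefMTwinsB
import Summits.ABC.IUTFork.Conditional.TSRefMTwinsC
import Summits.ABC.IUTFork.Conditional.TSRefMTwinsD
import Summits.ABC.IUTFork.Conditional.TSRefMTwinsG
import Summits.ABC.IUTFork.Conditional.TSRefMTwinsH
import Summits.ABC.IUTFork.Conditional.TSRefMTwinsI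
import Summits.ABC.IUTFork.Conditional.WRowModelClauseInhMB
import Mathlib.Tactic.IntervalCases
import Mathlib.Tactic.NormNum.Prime
import HarnessLib

/-!
# N3 TYPE-SPLIT axes, M LINE, ONE NAME FOR BOTH SIDES BY LOCAL TYPE — the M twin of `WRow.n3_typeSplit` (abc-iut-C-cert-1 gen 12,
# `Conditional/WRowN3TypeSplit.lean`, row «C:N3-K-TYPESPLIT»), its 9-row `(λ, P, a, b, Z, H, L)` list literal VERBATIM in the binder (bracketed sha16 `266a4e85a2c7b32d`)

PROOF-ONLY file (D-0012; 0 definitions, 0 `Prop` facts, no instance, no notation) of the abc-iut cell — branch C certificate seat abc-iut-C-cert-2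
(gen 10), standing duty (e) per RULING C-R177 (b): «next (e) candidate = the M twin of `WRow.n3_typeSplit` ONLY IF M-side typeband sockets exist BY
NAME» — they do, all 21 of them (listed below). TAKES NO SIDE on [IUTchIII] Cor. 3.12 (S. Mochizuki, *Inter-universal Teichmüller theory III*,
Cor. 3.12 p. 173–174; Step (xi-d) p. 183, (xi-f) p. 184) or on any author; «refuted / inhabited AS TYPED» over OUR sharp containers ≠ «refuted /
asserted in print».

THIS FILE: ONE junction theorem **`WRowM.n3_typeSplit_M`** — same binders as the K theorem (`hmem`, `hl : l.Prime`, `hP : P.Prime`, `T`), same two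
LOCAL-TYPE CLAUSES VERBATIM (they speak about the genuine datum's own `K = F(E[l])`-fibre over `P` through `kOf (pilotDataOfK T.D T.K) P x₀` and are,
byte for byte modulo the row's numerals, the `hloc` binders of the M typeband sockets): for every row, every prime `l`, every genuine Θ-volume datum
`T` over `(ratPoint λ, l)`:
(1) `Z ≤ l → l ≤ H → l ≠ P →` (every place of `K` over `P` has `e ∣ a·l`) `→` the M books' per-datum S_H object (settingPrVolSharpM, the datum's OWN
ideles, pinned q-reading) FAILS for every context / Kummer binder — conjunct (1) of `WRowM.n3_whole_M` (p557949) VERBATIM — BY NAME onto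
abc-iut-W-neg-1's M twins of abc-iut-W-num-6's «W:TS-BANDS» refuted typeband theorems (`GenuineM.not_pilotKummerCompatHull_triple_<N>_typeband_of_<m>` /
`…_typelevels_of_<m>`, `TSRefMTwinsA…I`);
(2) `L ≤ l →` (every place of `K` over `P` has `e = b·l`) `→` `Thm311ToCor312.Licence` at the M-level setting for EVERY idele datum `r` — conjunct (2)
of `WRowM.n3_whole_M` VERBATIM — BY NAME onto this seat's gen-7/8 M twins of the inhabited typeband theorems (`WRowM.licence_triple_<N>_typeband_e<k>_M`,
`…_typelevels_e10_M`, `…_typeband_e6_diff_M`; `RefBandsInhTypeBandsM*`, `RefBandsInhDiffM`, `WRowModelClauseInhM*`).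
The three one-line arithmetic side conditions of the K file (`WRow.n3TypeSplit_refLevel_*`, `…_inhLevel_1025227`) are copied here as PRIVATE lemmas
(pure `ℕ`; the K file is not imported on the M line). SAME `(P, a, b, Z, H, L)` per row as the K line.
HONEST SCOPE: inside the type-split zone the decision is GIVEN the local ramification type at `P`, exactly as on K; #32/#33 (IsSquare-type predicates)
are not in this table (own names: `GenuineM.…frey73_nineteen_of_not_isSquare` / `WRowM.isSquare_inh_*_M`); packaging — discharges nothing, changes
no census count; admissibility / Szpiro-badness / (P6) / NON-EMPTINESS of the datum type NOT claimed; typed ≠ proved; instantiated ≠ endorsed;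
no abc claim.
[cite: Mochizuki2012, IUTchI Def. 3.1 (b),(c) pp. 61–62, Ex. 3.2 (iv) p. 71; IUTchIII Cor. 3.12 Step (xi-d) p. 183, (xi-f) p. 184; IUTchIV Prop. 1.2 (i)(ii) p. 10, Prop. 1.4 (ii) p. 13, Cor. 2.2 (ii) proof (P5) p. 46]
[cite: DupuyHilado2025, §3.3, §3.4, §4.9, §4.12] [claim: Mochizuki2012, status: disputed] for every IUT sentence quoted.
-/

noncomputable section

open Set Function Metric NumberField IsDedekindDomain

namespace Summit.ABC.IUTFork.Conditional

open Thm311 Thm311.Real Cor312 Cor312Vol Cor312Prov Literature.IUT.LogThetaLattice Literature.IUT.LogVolume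
  Literature.IUT.HodgeTheaters Literature.IUT.LogVolume.Cor22
open Literature.NumberTheory.NumberFields Literature.NumberTheory.GaloisRepresentations.Ultrametric
open Literature.NumberTheory.DiophantineGeometry Literature.NumberTheory.DiophantineGeometry.GenEll

/-- Arithmetic side condition copied from the K file (`WRow.n3TypeSplit_refLevel_99794037551104`), pure `ℕ`. [folklore] -/
private theorem WRowM.n3TypeSplitM_refLevel_99794037551104 {l : ℕ} (hl : l.Prime) (hlo : 6129 < l) (hhi : l ≤ 6131) : l ∈ [6131] := by
  interval_cases l <;> first | (simp; done) | (exfalso; norm_num at hl)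

/-- Arithmetic side condition copied from the K file (`WRow.n3TypeSplit_refLevel_2707160810382798173125`), pure `ℕ`. [folklore] -/
private theorem WRowM.n3TypeSplitM_refLevel_2707160810382798173125 {l : ℕ} (hl : l.Prime) (hlo : 5645470 < l) (hhi : l ≤ 5645473) : l ∈ [5645473] := by
  interval_cases l <;> first | (simp; done) | (exfalso; norm_num at hl)

/-- Arithmetic side condition copied from the K file (`WRow.n3TypeSplit_inhLevel_1025227`), pure `ℕ`. [folklore] -/
private theorem WRowM.n3TypeSplitM_inhLevel_1025227 {l : ℕ} (hl : l.Prime) (hlo : 839 ≤ l) (hhi : l < 841) : l ∈ ([839] : List ℕ) := by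
  interval_cases l <;> first | (simp; done) | (exfalso; norm_num at hl)

/-- **«N3 TYPE-SPLIT BY LOCAL TYPE UNDER ONE THEOREM NAME» (M line)** — the M twin of `WRow.n3_typeSplit`, same 9-row
`(λ, P, a, b, Z, H, L)` list literal and the same local-type clauses: (1) `Z ≤ l ≤ H`, `l ≠ P`, type `e ∣ a·l` at every place over `P` ⇒ the M
books' per-datum S_H object (own ideles, pinned q-reading) FAILS for every context / Kummer binder; (2) `L ≤ l`, type `e = b·l` ⇒
`Thm311ToCor312.Licence` at the M-level setting for every idele datum. BY NAME onto the landed M typeband sockets; packaging — discharges nothing.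
[cite: Mochizuki2012, IUTchI Def. 3.1 (b),(c) pp. 61–62, Ex. 3.2 (iv) p. 71; IUTchIII Cor. 3.12 Step (xi-d) p. 183, (xi-f) p. 184; IUTchIV Prop. 1.2 (i)(ii) p. 10, Prop. 1.4 (ii) p. 13, Cor. 2.2 (ii) proof (P5) p. 46]
[cite: DupuyHilado2025, §3.3, §3.4, §4.9, §4.12] [claim: Mochizuki2012, status: disputed] -/
theorem WRowM.n3_typeSplit_M {q : ℚ} {P a b Z H L l : ℕ}
    (hmem : (q, P, a, b, Z, H, L) ∈ ([(((2 * 5 ^ 10 * 13 ^ 4 : ℕ) : ℚ) / (11 ^ 8 * 109 ^ 2 * 3677 ^ 3 : ℕ), 31, 15, 30, 7, 3704, 1847), (((2 ^ 11 * 3 ^ 4 * 101 ^ 4 * 29221 : ℕ) : ℚ) / (5 ^ 15 * 17 * 53093 ^ 2 : ℕ), 13, 15, 30, 7, 1211942736, 605971349), (((2 ^ 12 * 13 ^ 3 * 223 ^ 3 : ℕ) : ℚ) / (5 ^ 15 * 179 ^ 4 * 2141 : ℕ), 97, 3, 6, 7, 6131, 4091), (((2 ^ 2 * 3 ^ 4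 * 163 ^ 3 * 1006151 : ℕ) : ℚ) / (11 ^ 9 * 29 ^ 4 * 101 ^ 3 : ℕ), 43, 15, 30, 7, 804537078, 402268525), (((2 ^ 7 * 23 ^ 8 : ℕ) : ℚ) / (3 ^ 22 * 13 * 47 ^ 2 * 263 : ℕ), 19, 5, 10, 7, 46891, 23439), (((3 * 5 ^ 6 * 7 ^ 8 * 53 : ℕ) : ℚ) / (2 * 11 ^ 6 * 193 ^ 4 * 20551 : ℕ), 167, 5, 10, 7, 307414709, 153707347), (((5 ^ 14 * 19 : ℕ) : ℚ) / (11 ^ 7 * 37 ^ 2 * 353 : ℕ), 7, 15, 30, 7, 11735, 5857), (((5 ^ 4 * 19 ^ 13 * 103 : ℕ) : ℚ) / (3 ^ 19 * 11 ^ 4 * 463 ^ 5 : ℕ), 19, 15, 30, 7, 5645473, 2822723), (((7 ^ 5 * 61 : ℕ) : ℚ) / (3 ^ 13 * 5 ^ 8 * 11 ^ 3 * 53 * 73 ^ 2 * 89 ^ 2 * 103 : ℕ), 4229, 5, 10, 9, 1681, 839)] : List (ℚ × ℕ × ℕ × ℕ × ℕ × ℕ × ℕ)))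
    (hl : l.Prime) (hP : P.Prime) (T : Cor22.ThetaVolumeDatumAt (ratPoint q) l) :
    (Z ≤ l → l ≤ H → l ≠ P →
    letI := T.instFieldF; letI := T.instNumberFieldF; letI := T.instAlgebraF; letI := T.instFieldK
    letI := T.instNumberFieldK; letI := T.instAlgebraK; letI := T.instFieldFbar; letI := T.instAlgebraFbar
    letI := T.instAlgebraKFbar; letI := T.instIsElliptic
    (haveI : Fact (Nat.Prime P) := ⟨hP⟩
      ∀ x₀ : (thetaIndex (pilotDataOfK T.D T.K)).Fibre (.inr ⟨P, hP⟩),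
        absRamificationIdx P (kOf (pilotDataOfK T.D T.K) P x₀) ∣ a * l) →
    ∀ (M : Type) [Field M] [NumberField M]
      (archPk : ∀ (j : (thetaIndexOfInitial T.D).Label) (vQ : (thetaIndexOfInitial T.D).VQ),
        Set ((logShellsOfInitialDH T.D (analyticLogvVal T.K)).Packet j vQ))
      (archSub : ∀ (j : (thetaIndexOfInitial T.D).Label) (v : (thetaIndexOfInitial T.D).V),
        Set ((logShellsOfInitialDH T.D (analyticLogvVal T.K)).Packet j ((thetaIndexOfInitial T.D).over v)))
      (Ψ : ℤ → ∀ v : (thetaIndexOfInitial T.D).V, v ∈ (thetaIndexOfInitial T.D).Vbad →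
        Set ((logShellsOfInitialDH T.D (analyticLogvVal T.K)).StarPacket v))
      (act : ℤ → ∀ v : (thetaIndexOfInitial T.D).V, v ∈ (thetaIndexOfInitial T.D).Vbad →
        (logShellsOfInitialDH T.D (analyticLogvVal T.K)).StarPacket v →
          Module.End ℚ ((logShellsOfInitialDH T.D (analyticLogvVal T.K)).StarPacket v))
      (Mmod : ℤ → ∀ j : (thetaIndexOfInitial T.D).LabelStar, Set ((logShellsOfInitialDH T.D (analyticLogvVal T.K)).GlobalPacket j.1))
      (region : ℤ → ∀ j : (thetaIndexOfInitial T.D).LabelStar, FinDivisor M → ∀ vQ : (thetaIndexOfInitial T.D).VQ,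
        Set ((logShellsOfInitialDH T.D (analyticLogvVal T.K)).Packet j.1 vQ))
      (frobAdm : ℤ → ℤ → ∀ (j : (thetaIndexOfInitial T.D).Label) (vQ : (thetaIndexOfInitial T.D).VQ),
        Set ((logShellsOfInitialDH T.D (analyticLogvVal T.K)).Packet j vQ) → Prop)
      (frobLogvol : ℤ → ℤ → ∀ (j : (thetaIndexOfInitial T.D).Label) (vQ : (thetaIndexOfInitial T.D).VQ),
        Set ((logShellsOfInitialDH T.D (analyticLogvVal T.K)).Packet j vQ) → ℝ)
      (frobΨ : ℤ → ℤ → ∀ v : (thetaIndexOfInitial T.D).V, v ∈ (thetaIndexOfInitial T.D).Vbad →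
        Set ((logShellsOfInitialDH T.D (analyticLogvVal T.K)).StarPacket v))
      (frobMmod : ℤ → ℤ → ∀ j : (thetaIndexOfInitial T.D).LabelStar, Set ((logShellsOfInitialDH T.D (analyticLogvVal T.K)).GlobalPacket j.1))
      (unitImage : ℤ → ℤ → ℕ → ∀ (j : (thetaIndexOfInitial T.D).Label) (vQ : (thetaIndexOfInitial T.D).VQ),
        Set ((logShellsOfInitialDH T.D (analyticLogvVal T.K)).Packet j vQ))
      (ballImage : ℤ → ℤ → ∀ (j : (thetaIndexOfInitial T.D).Label) (vQ : (thetaIndexOfInitial T.D).VQ),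
        Set ((logShellsOfInitialDH T.D (analyticLogvVal T.K)).Packet j vQ))
      (thetaDiv : ℤ → ℤ → LgpDivisor M (thetaIndexOfInitial T.D).lstar)
      (n : ℤ) {HT : Type} {LogLink : HT → HT → Type} {IsFull : ∀ {s t : HT}, LogLink s t → Prop}
      (lat : LGPGaussianLogThetaLattice LogLink IsFull)
      {Frd : Type} {IsoF : Frd → Frd → Type} {Ob : Frd → Type} {realify : Frd → Frd} {Strip : Type}
      {IsoS : Strip → Strip → Type} {Mv : ∀ v : (thetaIndexOfInitial T.D).V, v ∈ (thetaIndexOfInitial T.D).Vbad → Type}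
      [∀ v h, Monoid (Mv v h)]
      (sig : GlobalLGPFrobenioidSignature (thetaIndexOfInitial T.D).lstar (thetaIndexOfInitial T.D).V
        (· ∈ (thetaIndexOfInitial T.D).Vbad) Frd IsoF Ob realify Strip IsoS Mv)
      (split : SplittingMonoids Mv) {ObΔ : Type} {N : ∀ v : (thetaIndexOfInitial T.D).V, v ∈ (thetaIndexOfInitial T.D).Vbad → Type}
      [∀ v h, Monoid (N v h)] (qData : QPilotData ObΔ N)
      (qK : ∀ v : (thetaIndexOfInitial T.D).V, v ∈ (thetaIndexOfInitial T.D).Vbad →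
        Set ((logShellsOfInitialDH T.D (analyticLogvVal T.K)).StarPacket v)),
      ¬ Cor312Vol.PilotKummerCompatHull
        (LatticeSituation.ofShells (logShellsOfInitialDH T.D (analyticLogvVal T.K)) M archPk archSub
          (summandPiecesPrM T.D (logvAnalyticVal_analyticLogvVal (K := T.K))).Adm (summandPiecesPrM T.D (logvAnalyticVal_analyticLogvVal (K := T.K))).logvol Ψ act Mmod region frobAdm frobLogvol
          frobΨ frobMmod unitImage ballImage thetaDiv)
        (settingPrVolSharpM T.D (logvAnalyticVal_analyticLogvVal (K := T.K)) (tOfIdeleData T.D (ideleDataOf T.D T.isVolumeInputOf))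
          (fun u x => tqM T.D (ratChar u) u (natCast_ratChar_mem u) (ideleDataOf T.D T.isVolumeInputOf) x) M archPk archSub Ψ act Mmod region n lat sig split qData
          (fun u x => tqM_ne_zero T.D (ratChar u) u (natCast_ratChar_mem u) (ideleDataOf T.D T.isVolumeInputOf) x)
          (GenuineM.finite_ratPlaces_under_S T.D).toFinset
          (fun u x hu => norm_tqM_eq_one_of_not_mem T.D (ratChar u) u (natCast_ratChar_mem u) (ideleDataOf T.D T.isVolumeInputOf) x
            fun hx => hu ((Set.Finite.mem_toFinset _).mpr ⟨x, hx⟩)))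
        (fun _ => Cor312.Setting.qRegion
          (settingPrVolSharpM T.D (logvAnalyticVal_analyticLogvVal (K := T.K)) (tOfIdeleData T.D (ideleDataOf T.D T.isVolumeInputOf))
          (fun u x => tqM T.D (ratChar u) u (natCast_ratChar_mem u) (ideleDataOf T.D T.isVolumeInputOf) x) M archPk archSub Ψ act Mmod region n lat sig split qData
          (fun u x => tqM_ne_zero T.D (ratChar u) u (natCast_ratChar_mem u) (ideleDataOf T.D T.isVolumeInputOf) x)
          (GenuineM.finite_ratPlaces_under_S T.D).toFinset
          (fun u x hu => norm_tqM_eq_one_of_not_mem T.D (ratChar u) u (natCast_ratChar_mem u) (ideleDataOf T.D T.isVolumeInputOf) x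
            fun hx => hu ((Set.Finite.mem_toFinset _).mpr ⟨x, hx⟩)))) qK) ∧
    (L ≤ l →
    letI := T.instFieldF; letI := T.instNumberFieldF; letI := T.instAlgebraF; letI := T.instFieldK
    letI := T.instNumberFieldK; letI := T.instAlgebraK; letI := T.instFieldFbar; letI := T.instAlgebraFbar
    letI := T.instAlgebraKFbar; letI := T.instIsElliptic
    (haveI : Fact (Nat.Prime P) := ⟨hP⟩
      ∀ x₀ : (thetaIndex (pilotDataOfK T.D T.K)).Fibre (.inr ⟨P, hP⟩),
        absRamificationIdx P (kOf (pilotDataOfK T.D T.K) P x₀) = b * l) →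
    ∀ {logvK : PadicLogsVal T.K} (hlog : LogvAnalyticVal logvK) (r : ThetaData.IdeleData T.D) (M : Type) [Field M] [NumberField M]
      (archPk : ∀ (j : (thetaIndexOfInitial T.D).Label) (vQ : (thetaIndexOfInitial T.D).VQ),
        Set ((logShellsOfInitialDH T.D logvK).Packet j vQ))
      (archSub : ∀ (j : (thetaIndexOfInitial T.D).Label) (v : (thetaIndexOfInitial T.D).V),
        Set ((logShellsOfInitialDH T.D logvK).Packet j ((thetaIndexOfInitial T.D).over v)))
      (Ψ : ℤ → ∀ v : (thetaIndexOfInitial T.D).V, v ∈ (thetaIndexOfInitial T.D).Vbad →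
        Set ((logShellsOfInitialDH T.D logvK).StarPacket v))
      (act : ℤ → ∀ v : (thetaIndexOfInitial T.D).V, v ∈ (thetaIndexOfInitial T.D).Vbad →
        (logShellsOfInitialDH T.D logvK).StarPacket v → Module.End ℚ ((logShellsOfInitialDH T.D logvK).StarPacket v))
      (Mmod : ℤ → ∀ j : (thetaIndexOfInitial T.D).LabelStar, Set ((logShellsOfInitialDH T.D logvK).GlobalPacket j.1))
      (region : ℤ → ∀ j : (thetaIndexOfInitial T.D).LabelStar, FinDivisor M → ∀ vQ : (thetaIndexOfInitial T.D).VQ,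
        Set ((logShellsOfInitialDH T.D logvK).Packet j.1 vQ))
      (n : ℤ) {HT : Type} {LogLink : HT → HT → Type} {IsFull : ∀ {s t : HT}, LogLink s t → Prop}
      (lat : LGPGaussianLogThetaLattice LogLink IsFull)
      {Frd : Type} {IsoF : Frd → Frd → Type} {Ob : Frd → Type} {realify : Frd → Frd} {Strip : Type}
      {IsoS : Strip → Strip → Type}
      {Mv : ∀ v : (thetaIndexOfInitial T.D).V, v ∈ (thetaIndexOfInitial T.D).Vbad → Type} [∀ v h, Monoid (Mv v h)]
      (sig : GlobalLGPFrobenioidSignature (thetaIndexOfInitial T.D).lstar (thetaIndexOfInitial T.D).V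
        (· ∈ (thetaIndexOfInitial T.D).Vbad) Frd IsoF Ob realify Strip IsoS Mv)
      (split : SplittingMonoids Mv) {ObΔ : Type}
      {N : ∀ v : (thetaIndexOfInitial T.D).V, v ∈ (thetaIndexOfInitial T.D).Vbad → Type} [∀ v h, Monoid (N v h)]
      (qData : QPilotData ObΔ N)
      (htq0 : ∀ (u : FinitePlace ℚ) (x : (thetaIndexOfInitial T.D).Fibre (Val.non u)),
        tqM T.D (ratChar u) u (natCast_ratChar_mem u) r x ≠ 0)
      (Sq : Finset (FinitePlace ℚ))
      (htq1 : ∀ (u : FinitePlace ℚ) (x : (thetaIndexOfInitial T.D).Fibre (Val.non u)), u ∉ Sq →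
        ‖tqM T.D (ratChar u) u (natCast_ratChar_mem u) r x‖ = 1),
      Thm311ToCor312.Licence
        (settingPrVolSharpM T.D hlog (tOfIdeleData T.D r) (fun u x => tqM T.D (ratChar u) u (natCast_ratChar_mem u) r x) M archPk
          archSub Ψ act Mmod region n lat sig split qData htq0 Sq htq1)) := by
  simp only [List.mem_cons, Prod.mk.injEq, List.not_mem_nil, or_false] at hmem
  rcases hmem with ⟨rfl, rfl, rfl, rfl, rfl, rfl, rfl⟩ | ⟨rfl, rfl, rfl, rfl, rfl, rfl, rfl⟩ | ⟨rfl, rfl, rfl, rfl, rfl, rfl, rfl⟩ | ⟨rfl, rfl, rfl, rfl, rfl, rfl, rfl⟩ | ⟨rfl, rfl, rfl, rfl, rfl, rfl, rfl⟩ | ⟨rfl, rfl, rfl, rfl, rfl, rfl, rfl⟩ | ⟨rfl, rfl, rfl, rfl, rfl, rfl, rfl⟩ | ⟨rfl, rfl, rfl, rfl, rfl, rfl, rfl⟩ | ⟨rfl, rfl, rfl, rfl, rfl, rfl, rfl⟩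

  · -- #8 N = 557832031250: pole P = 31; REF-type e ∣ 15·l on [7, 3704] ∖ {P}; INH-type e = 30·l on [1847, ∞)
    refine ⟨fun hZ hH hne hloc => ?_, fun hL hloc => ?_⟩
    · exact GenuineM.not_pilotKummerCompatHull_triple_557832031250_typeband_of_fifteen hl hZ hH hne T hloc
    · exact WRowM.licence_triple_557832031250_typeband_e30_M hl hL T hloc
  · -- #12 N = 504423766399592448: pole P = 13; REF-type e ∣ 15·l on [7, 1211942736] ∖ {P}; INH-type e = 30·l on [605971349, ∞)
    refine ⟨fun hZ hH hne hloc => ?_, fun hL hloc => ?_⟩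
    · exact GenuineM.not_pilotKummerCompatHull_triple_504423766399592448_typeband_of_fifteen hl hZ hH hne T hloc
    · exact WRowM.licence_triple_504423766399592448_typeband_e30_M hl hL T hloc
  · -- #13 N = 99794037551104: pole P = 97; REF-type e ∣ 3·l on [7, 6131] ∖ {P}; INH-type e = 6·l on [4091, ∞)
    refine ⟨fun hZ hH hne hloc => ?_, fun hL hloc => ?_⟩
    · rcases le_or_gt l 6129 with hB | hB
      · exact GenuineM.not_pilotKummerCompatHull_triple_99794037551104_typeband_of_three hl hZ hB hne T hloc
      · exact GenuineM.not_pilotKummerCompatHull_triple_99794037551104_typelevels_of_three hl (WRowM.n3TypeSplitM_refLevel_99794037551104 hl hB hH) hne T hloc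
    · exact WRowM.licence_triple_99794037551104_typeband_e6_diff_M hl hL T hloc
  · -- #16 N = 1411792877634228: pole P = 43; REF-type e ∣ 15·l on [7, 804537078] ∖ {P}; INH-type e = 30·l on [402268525, ∞)
    refine ⟨fun hZ hH hne hloc => ?_, fun hL hloc => ?_⟩
    · exact GenuineM.not_pilotKummerCompatHull_triple_1411792877634228_typeband_of_fifteen hl hZ hH hne T hloc
    · exact WRowM.licence_triple_1411792877634228_typeband_e30_M hl hL T hloc
  · -- #20 N = 10023806115968: pole P = 19; REF-type e ∣ 5·l on [7, 46891] ∖ {P}; INH-type e = 10·l on [23439, ∞)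
    refine ⟨fun hZ hH hne hloc => ?_, fun hL hloc => ?_⟩
    · exact GenuineM.not_pilotKummerCompatHull_triple_10023806115968_typeband_of_five hl hZ hH hne T hloc
    · exact WRowM.licence_triple_10023806115968_typeband_e10_M hl hL T hloc
  · -- #21 N = 14321927484375: pole P = 167; REF-type e ∣ 5·l on [7, 307414709] ∖ {P}; INH-type e = 10·l on [153707347, ∞)
    refine ⟨fun hZ hH hne hloc => ?_, fun hL hloc => ?_⟩
    · exact GenuineM.not_pilotKummerCompatHull_triple_14321927484375_typeband_of_five hl hZ hH hne T hloc
    · exact WRowM.licence_triple_14321927484375_typeband_e10_M hl hL T hloc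
  · -- #28 N = 115966796875: pole P = 7; REF-type e ∣ 15·l on [7, 11735] ∖ {P}; INH-type e = 30·l on [5857, ∞)
    refine ⟨fun hZ hH hne hloc => ?_, fun hL hloc => ?_⟩
    · exact GenuineM.not_pilotKummerCompatHull_triple_115966796875_typeband_of_fifteen hl hZ hH hne T hloc
    · exact WRowM.licence_triple_115966796875_typeband_e30_M hl hL T hloc
  · -- #30 N = 2707160810382798173125: pole P = 19; REF-type e ∣ 15·l on [7, 5645473] ∖ {P}; INH-type e = 30·l on [2822723, ∞)
    refine ⟨fun hZ hH hne hloc => ?_, fun hL hloc => ?_⟩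
    · rcases le_or_gt l 5645470 with hB | hB
      · exact GenuineM.not_pilotKummerCompatHull_triple_2707160810382798173125_typeband_of_fifteen hl hZ hB hne T hloc
      · exact GenuineM.not_pilotKummerCompatHull_triple_2707160810382798173125_typelevels_of_fifteen hl (WRowM.n3TypeSplitM_refLevel_2707160810382798173125 hl hB hH) hne T hloc
    · exact WRowM.licence_triple_2707160810382798173125_typeband_e30_M hl hL T hloc
  · -- #37 N = 1025227: pole P = 4229; REF-type e ∣ 5·l on [9, 1681] ∖ {P}; INH-type e = 10·l on [839, ∞)
    refine ⟨fun hZ hH hne hloc => ?_, fun hL hloc => ?_⟩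
    · exact GenuineM.not_pilotKummerCompatHull_triple_1025227_typeband_of_five hl hZ hH hne T hloc
    · rcases le_or_gt 841 l with hB | hB
      · exact WRowM.licence_triple_1025227_typeband_e10_M hl hB T hloc
      · exact WRowM.licence_triple_1025227_typelevels_e10_M hl (WRowM.n3TypeSplitM_inhLevel_1025227 hl hL hB) T hloc

end Summit.ABC.IUTFork.Conditional

end
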